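/-
Copyright: the b2b-balaban T⁴-continuum CRUX team, row NE7b OWNER lineage `t4-ne7b-p1` (gen 147). Project licence.
-/
import Summits.QuantumFields.BalabanUV.T4Continuum.Spine.NE7b.SupWeightedKernelLetterTransportFour

/-!
# THE WEIGHTED TRANSPORT AT ORDER FOUR IN THE OTHER THREE ROLES ((770) continued; file (774)).  (770) transported the first-index full-graph
# letter of a nonnegative order-4 majorant through `t • J_β`; the class carries the letter in FOUR roles (slot shapes of (662)–(665)).  THIS FILE
# derives the second-, third- and fourth-index transports from (770) applied to the kernel with permuted arguments: the fibre sums inside the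
# coarse majorant commute and the weights (fine and coarse) are symmetric, so both sides agree up to the commutative-monoid normal form of the
# weight products (row NE7b, node U5c; (770) BY NAME; Mathlib; [folklore]).

Cell `pub-balaban`, sub-cell `t4`, spine estimate NE7b (`T4WeightBudget.RelWeightBound`; the cell's OWN estimate — NOT PRINTED in
[Bałaban 1983–89], NOT PROVED).  Crux-route work under `Spine/NE7b/` by the row OWNER (`t4-ne7b-p1` gen 147, file (774)) under FREEZE
(0)'s crux-prover clause; NOTHING of Bałaban's is named as a Lean object, valued or asserted; no `T4Continuum/Support` leaf typed; no
`def`, no notation; zero `sorry`.  Imports (BY NAME): (770) `…SupWeightedKernelLetterTransportFour`.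

WHAT IS PROVED ([folklore]): **`weighted_coarse_k4_letter_le_second`**, **`weighted_coarse_k4_letter_le_third`**, **`weighted_coarse_k4_letter_le_fourth`**; toy.

HONEST (what this is NOT).  Finite-sum bookkeeping (order 5's other roles and the flow of the letter values not typed); scalar skeleton
((A3), NC-NE7b-α UNRULED); nothing of Bałaban's asserted.  BY-NAME EFFECT ON THE WALL: NONE.  NE7b NOT PRINTED ∕ NOT PROVED; spine PROVED
0∕9; rung (B)+1 — the programme's measures remain FINITE-torus statements; NOT the mass gap, NOT Clay.  HONEST DEPENDENCY: continuum YM on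
T⁴ ⇐ BetaPertH ∧ nine spine estimates (0∕9 proved); BetaPertH ⇐ (D1) ∧ (D4) ∧ CAP+tail; G-an2-4 gates asym, D1 and NE2∕3∕4.
-/

set_option autoImplicit false

noncomputable section

namespace Summit.QuantumFields.BalabanUV.T4Continuum.NE7b.SupWeightedKernelLetterTransportFourRoles

open Finset
open scoped BigOperators
open SupWeightedKernelLetterTransportFour (weighted_coarse_k4_letter_le)

variable {ι ι' : Type} [Fintype ι] [Fintype ι'] [DecidableEq ι']

/-! ## The three remaining roles at order 4 -/

/-- **ORDER 4, SECOND INDEX FIXED** (slot shape of the class): from the first-index transport (770) applied to the kernel with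
permuted arguments (`fun a b c d => K4 b a c d`); the fibre sums inside the coarse majorant commute and the weights are symmetric. [folklore] -/
theorem weighted_coarse_k4_letter_le_second (β : ι → ι') {n : ℕ} (hfib : ∀ y, (univ.filter fun x => β x = y).card ≤ n)
    (K4 : ι → ι → ι → ι → ℝ) (hK : ∀ a b c d, 0 ≤ K4 a b c d) {ϑ : ι → ι → ℝ} {ϑc : ι' → ι' → ℝ} {M κ : ℝ} (hM : 0 ≤ M)
    (hϑ0 : ∀ x x', 0 ≤ ϑ x x') (hϑsymm : ∀ x x', ϑ x x' = ϑ x' x) (hϑc0 : ∀ y y', 0 ≤ ϑc y y') (hϑcsymm : ∀ y y', ϑc y y' = ϑc y' y)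
    (hϑ : ∀ x x', ϑc (β x) (β x') ≤ M * ϑ x x') (hκ : 0 ≤ κ)
    (hk : ∀ z, ∑ x, ∑ y, ∑ tt, K4 y z tt x * (ϑ x y * ϑ x z * ϑ x tt * ϑ y z * ϑ y tt * ϑ z tt) ≤ κ) (t : ℝ) (y₁ : ι') :
    ∑ X, ∑ Y, ∑ T,
        (t ^ 4 * ∑ a ∈ Finset.univ.filter (fun a => β a = Y), ∑ b ∈ Finset.univ.filter (fun b => β b = y₁), ∑ c ∈ Finset.univ.filter (fun c => β c = T), ∑ d ∈
          Finset.univ.filter (fun d => β d = X), K4 a b c d) * (ϑc X Y * ϑc X y₁ * ϑc X T * ϑc Y y₁ * ϑc Y T * ϑc y₁ T) ≤ t ^ 4 * n * M ^ 6 * κ := by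
  have hk2 : ∀ z, ∑ x, ∑ y, ∑ tt, K4 y z tt x * (ϑ x z * ϑ x y * ϑ x tt * ϑ z y * ϑ z tt * ϑ y tt) ≤ κ := fun i => by
    simpa only [hϑsymm, mul_comm, mul_left_comm, mul_assoc] using hk i
  have h := weighted_coarse_k4_letter_le β hfib (fun a b c d => K4 b a c d) (fun a b c d => hK b a c d) hM hϑ0 hϑc0 hϑ hκ hk2 t y₁
  simp only [hϑcsymm, mul_comm, mul_left_comm, mul_assoc] at h ⊢
  simpa only [Finset.sum_comm (s := Finset.univ.filter (fun _ => β _ = y₁))] using h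

/-- **ORDER 4, THIRD INDEX FIXED** (slot shape of the class): from the first-index transport (770) applied to the kernel with
permuted arguments (`fun a b c d => K4 b c a d`); the fibre sums inside the coarse majorant commute and the weights are symmetric. [folklore] -/
theorem weighted_coarse_k4_letter_le_third (β : ι → ι') {n : ℕ} (hfib : ∀ y, (univ.filter fun x => β x = y).card ≤ n)
    (K4 : ι → ι → ι → ι → ℝ) (hK : ∀ a b c d, 0 ≤ K4 a b c d) {ϑ : ι → ι → ℝ} {ϑc : ι' → ι' → ℝ} {M κ : ℝ} (hM : 0 ≤ M)
    (hϑ0 : ∀ x x', 0 ≤ ϑ x x') (hϑsymm : ∀ x x', ϑ x x' = ϑ x' x) (hϑc0 : ∀ y y', 0 ≤ ϑc y y') (hϑcsymm : ∀ y y', ϑc y y' = ϑc y' y)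
    (hϑ : ∀ x x', ϑc (β x) (β x') ≤ M * ϑ x x') (hκ : 0 ≤ κ)
    (hk : ∀ tt, ∑ x, ∑ y, ∑ z, K4 y z tt x * (ϑ x y * ϑ x z * ϑ x tt * ϑ y z * ϑ y tt * ϑ z tt) ≤ κ) (t : ℝ) (y₁ : ι') :
    ∑ X, ∑ Y, ∑ Z,
        (t ^ 4 * ∑ a ∈ Finset.univ.filter (fun a => β a = Y), ∑ b ∈ Finset.univ.filter (fun b => β b = Z), ∑ c ∈ Finset.univ.filter (fun c => β c = y₁), ∑ d ∈
          Finset.univ.filter (fun d => β d = X), K4 a b c d) * (ϑc X Y * ϑc X Z * ϑc X y₁ * ϑc Y Z * ϑc Y y₁ * ϑc Z y₁) ≤ t ^ 4 * n * M ^ 6 * κ := by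
  have hk2 : ∀ tt, ∑ x, ∑ y, ∑ z, K4 y z tt x * (ϑ x tt * ϑ x y * ϑ x z * ϑ tt y * ϑ tt z * ϑ y z) ≤ κ := fun i => by
    simpa only [hϑsymm, mul_comm, mul_left_comm, mul_assoc] using hk i
  have h := weighted_coarse_k4_letter_le β hfib (fun a b c d => K4 b c a d) (fun a b c d => hK b c a d) hM hϑ0 hϑc0 hϑ hκ hk2 t y₁
  simp only [hϑcsymm, mul_comm, mul_left_comm, mul_assoc] at h ⊢
  simpa only [Finset.sum_comm (s := Finset.univ.filter (fun _ => β _ = y₁))] using h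

/-- **ORDER 4, FOURTH INDEX FIXED** (slot shape of the class): from the first-index transport (770) applied to the kernel with
permuted arguments (`fun a b c d => K4 b c d a`); the fibre sums inside the coarse majorant commute and the weights are symmetric. [folklore] -/
theorem weighted_coarse_k4_letter_le_fourth (β : ι → ι') {n : ℕ} (hfib : ∀ y, (univ.filter fun x => β x = y).card ≤ n)
    (K4 : ι → ι → ι → ι → ℝ) (hK : ∀ a b c d, 0 ≤ K4 a b c d) {ϑ : ι → ι → ℝ} {ϑc : ι' → ι' → ℝ} {M κ : ℝ} (hM : 0 ≤ M)
    (hϑ0 : ∀ x x', 0 ≤ ϑ x x') (hϑsymm : ∀ x x', ϑ x x' = ϑ x' x) (hϑc0 : ∀ y y', 0 ≤ ϑc y y') (hϑcsymm : ∀ y y', ϑc y y' = ϑc y' y)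
    (hϑ : ∀ x x', ϑc (β x) (β x') ≤ M * ϑ x x') (hκ : 0 ≤ κ)
    (hk : ∀ x, ∑ y, ∑ z, ∑ tt, K4 y z tt x * (ϑ x y * ϑ x z * ϑ x tt * ϑ y z * ϑ y tt * ϑ z tt) ≤ κ) (t : ℝ) (y₁ : ι') :
    ∑ Y, ∑ Z, ∑ T,
        (t ^ 4 * ∑ a ∈ Finset.univ.filter (fun a => β a = Y), ∑ b ∈ Finset.univ.filter (fun b => β b = Z), ∑ c ∈ Finset.univ.filter (fun c => β c = T), ∑ d ∈
          Finset.univ.filter (fun d => β d = y₁), K4 a b c d) * (ϑc y₁ Y * ϑc y₁ Z * ϑc y₁ T * ϑc Y Z * ϑc Y T * ϑc Z T) ≤ t ^ 4 * n * M ^ 6 * κ := by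
  have hk2 : ∀ y, ∑ x, ∑ z, ∑ tt, K4 z tt x y * (ϑ x y * ϑ x z * ϑ x tt * ϑ y z * ϑ y tt * ϑ z tt) ≤ κ := fun i => by
    have e : (∑ x, ∑ z, ∑ tt, K4 z tt x i * (ϑ x i * ϑ x z * ϑ x tt * ϑ i z * ϑ i tt * ϑ z tt)) =
        ∑ z, ∑ tt, ∑ x, K4 z tt x i * (ϑ x i * ϑ x z * ϑ x tt * ϑ i z * ϑ i tt * ϑ z tt) :=
      Finset.sum_comm.trans (Finset.sum_congr rfl fun _ _ => Finset.sum_comm)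
    rw [e]
    simpa only [hϑsymm, mul_comm, mul_left_comm, mul_assoc] using hk i
  have h := weighted_coarse_k4_letter_le β hfib (fun a b c d => K4 b c d a) (fun a b c d => hK b c d a) hM hϑ0 hϑc0 hϑ hκ hk2 t y₁
  rw
      [show (∑ Y, ∑ Z, ∑ T, (t ^ 4 * ∑ a ∈ Finset.univ.filter (fun a => β a = Y), ∑ b ∈ Finset.univ.filter (fun b => β b = Z), ∑ c ∈ Finset.univ.filter (fun c => β c = T), ∑ d ∈ Finset.univ.filter (fun d => β d = y₁), K4 a b c d) * (ϑc y₁ Y * ϑc y₁ Z * ϑc y₁ T * ϑc Y Z * ϑc Y T * ϑc Z T)) = ∑ T, ∑ Y, ∑ Z, (t ^ 4 * ∑ a ∈ Finset.univ.filter (fun a => β a = Y), ∑ b ∈ Finset.univ.filter (fun b => β b = Z), ∑ c ∈ Finset.univ.filter (fun c => β c = T), ∑ d ∈ Finset.univ.filter (fun d => β d = y₁), K4 a b c d) * (ϑc y₁ Y * ϑc y₁ Z * ϑc y₁ T * ϑc Y Z * ϑc Y T * ϑc Z T) from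
    (Finset.sum_congr rfl fun _ _ => Finset.sum_comm).trans Finset.sum_comm]
  simp only [hϑcsymm, mul_comm, mul_left_comm, mul_assoc] at h ⊢
  simpa only [Finset.sum_comm (s := Finset.univ.filter (fun _ => β _ = y₁))] using h

/-! ## Toy -/

/-- Toy (the normal form of a weight product): `a·b·c = c·(b·a)`. -/
example (a b c : ℝ) : a * b * c = c * (b * a) := by ring

end Summit.QuantumFields.BalabanUV.T4Continuum.NE7b.SupWeightedKernelLetterTransportFourRoles

end
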